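import Summits.KontsevichZagierPeriods.KontsevichZagierPeriods.Theorems.ComplexOrientationsCauchyMoveBoundaryQ
import Summits.KontsevichZagierPeriods.KontsevichZagierPeriods.Theorems.ComplexOrientationsCauchyMoveGreen
import Summits.KontsevichZagierPeriods.KontsevichZagierPeriods.Theorems.ComplexOrientationsCauchyMoveAlgGraphDeriv
import Summits.KontsevichZagierPeriods.KontsevichZagierPeriods.Theses.ComplexOrientations

/-!
# Route `ComplexOrientations`, support item `CauchyMove` (stmt-KontsevichZagierPeriods-11370):
# **`CauchyMove` holds** — Cauchy's theorem for an algebraic germ on a rational circle is a chain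
# of Kontsevich–Zagier moves

`cauchyMove_proof : CauchyMove`. For `0 < ρ < R`, `ρ` real algebraic, `g` holomorphic on
`‖t‖ < R` with `P(t, g t) = 0` for a non-zero `P ∈ ℚ[t, w]`, and any integral representation `r`
over `ℝ¹` with integrand `s ↦ Re (g(γ s) γ'(s))`, `γ(s) = ρ (1 + is)/(1 − is)`: `[r] ∈ KZ.relations`.

Proof (`cauchy_chain`, then Theorem A): by rule (1b), `[r] = [rP] + [rQ]` with
`rP = [ℝ, Re g(γ) Re γ']`, `rQ = [ℝ, −Im g(γ) Im γ']` (both absolutely convergent: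
`|·| ≤ 2ρ‖g‖_∞/(1 + s²)`); `boundaryP`/`boundaryQ` turn these into minus the two edge
representations of the disc, which sum to a relation by `green` (Newton–Leibniz with primitives
`Re g`, `Im g`, coordinate swap, Cauchy–Riemann). The semialgebraicity inputs — `Re g`, `Im g`,
`Im g'` are `ℚ`-semialgebraic on the closed disc — are Theorem A (`re_im_algHolo`,
`re_im_algHolo_deriv`, files `ComplexOrientationsCauchyMoveAlgGraph*.lean`) applied on a rational
radius `ρ < R₁ < R` after renaming the variables of `P` to the `(w, t)` convention.

Sources: M. Kontsevich, D. Zagier, *Periods* (2001), §1.2; J. Bochnak, M. Coste, M.-F. Roy,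
*Real Algebraic Geometry* (1998), §2.2, Ch. 8. Fully proved; axioms `propext`,
`Classical.choice`, `Quot.sound`.
-/

noncomputable section

open MvPolynomial Set Metric MeasureTheory
open Literature.ModelTheory.ExponentialFields Literature.NumberTheory.Transcendental
open Literature.NumberTheory.Transcendental.KZ

namespace Summit.KontsevichZagierPeriods.ComplexOrientations.CauchyMoveAux

/-- The complex number `x₀ + i x₁` attached to a point `x ∈ ℝ²` (local notation). -/
local notation:max "cx " x:max => (Complex.mk (x 0) (x 1))

/-- The complex number `x₁ + i x₀` attached to a point `x ∈ ℝ²` (swapped; local notation). -/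
local notation:max "cxs " x:max => (Complex.mk (x 1) (x 0))

variable {ρ R' : ℝ} {g : ℂ → ℂ}

section Boundary

/-- `γ(s) = ρ (1 + i s)/(1 - i s)` (local notation; `ρ` is the section variable). -/
local notation:max "γc " s:max => ((ρ : ℂ) * (1 + ((s : ℝ) : ℂ) * Complex.I) / (1 - ((s : ℝ) : ℂ) * Complex.I))

/-- `γ'(s) = 2 i ρ/(1 - i s)²` (local notation). -/
local notation:max "γc' " s:max => ((ρ : ℂ) * (2 * Complex.I) / (1 - ((s : ℝ) : ℂ) * Complex.I) ^ 2)

/-- `γ'` is continuous on `ℝ`. -/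
theorem continuous_gamma' (ρ : ℝ) :
    Continuous fun s : ℝ => (ρ : ℂ) * (2 * Complex.I) / (1 - (s : ℂ) * Complex.I) ^ 2 :=
  Continuous.div continuous_const (by fun_prop) fun s => pow_ne_zero 2 (one_sub_mul_I_ne_zero s)

/-- **Cauchy's theorem for an algebraic germ on the rational circle, as a chain of KZ moves**
(given the `ℚ`-semialgebraicity of `Re g`, `Im g`, `Im g'` on the closed disc): the
representation `[ℝ, s ↦ Re (g(γ s) γ'(s))]` lies in `KZ.relations`. Assembly of `green`,
`boundaryP`, `boundaryQ` with the split `Re (g γ') = Re g · Re γ' − Im g · Im γ'` (rule (1b)). -/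
theorem cauchy_chain (hρ : 0 < ρ) (halg : IsAlgebraic ℚ ρ) (hR : ρ < R')
    (hg : DifferentiableOn ℂ g (ball 0 R'))
    (hPs : IsSemialgebraicFunOn ℚ {x : Fin 2 → ℝ | x 0 ^ 2 + x 1 ^ 2 ≤ ρ ^ 2}
      (fun x => (g (cx x)).re))
    (hQs : IsSemialgebraicFunOn ℚ {x : Fin 2 → ℝ | x 0 ^ 2 + x 1 ^ 2 ≤ ρ ^ 2}
      (fun x => (g (cx x)).im))
    (hHs : IsSemialgebraicFunOn ℚ {x : Fin 2 → ℝ | x 0 ^ 2 + x 1 ^ 2 ≤ ρ ^ 2}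
      (fun x => (deriv g (cx x)).im))
    (r : IntegralRep 1) (hrd : r.domain = univ)
    (hri : ∀ z : Fin 1 → ℝ, r.integrand z = (g (γc (z 0)) * γc' (z 0)).re) :
    of r ∈ relations := by
  obtain ⟨rd, rd', hdd, hdi, hdd', hdi', hgreen⟩ := green hρ halg hR hg hPs hQs hHs
  obtain ⟨M, hM⟩ := exists_bound_g_gamma hρ hR hg
  have hM0 : 0 ≤ M := le_trans (norm_nonneg _) (hM 0)
  have hgγ : Continuous fun s : ℝ => g (γc s) := continuous_g_gamma hρ hR hg
  have hγ' : Continuous fun s : ℝ => γc' s := continuous_gamma' ρ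
  have hbound : ∀ s : ℝ, ∀ a b : ℝ, |a| ≤ ‖g (γc s)‖ → |b| ≤ ‖γc' s‖ →
      |a * b| ≤ 2 * |ρ| * M / (1 + s ^ 2) := by
    intro s a b ha hb
    rw [abs_mul]
    have h1 : |b| ≤ 2 * |ρ| / (1 + s ^ 2) := by rw [← norm_gamma']; exact hb
    calc |a| * |b| ≤ M * (2 * |ρ| / (1 + s ^ 2)) :=
          mul_le_mul (ha.trans (hM s)) h1 (abs_nonneg _) hM0
      _ = 2 * |ρ| * M / (1 + s ^ 2) := by ring
  -- the representation `[ℝ, Re g(γ) · Re γ']`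
  have hPg : IsSemialgebraicFunOn ℚ (univ : Set (Fin 1 → ℝ)) fun z => (g (γc (z 0))).re :=
    (isSemialgebraicFunOn_comp_gamma halg isSemialgebraic_univ hPs).congr fun z _ => by
      simp only [cx_gamma]
  have hPsa : IsSemialgebraicFunOn ℚ (univ : Set (Fin 1 → ℝ))
      fun z => (g (γc (z 0))).re * (γc' (z 0)).re :=
    IsSemialgebraicFunOn.mul_holds hPg (isSemialgebraicFunOn_gamma'_re halg isSemialgebraic_univ)
  have hPint : IntegrableOn (fun z : Fin 1 → ℝ => (g (γc (z 0))).re * (γc' (z 0)).re) univ := by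
    rw [integrableOn_univ]
    exact integrable_fin1 (F := fun s => (g (γc s)).re * (γc' s).re)
      (Continuous.mul (f := fun s : ℝ => (g (γc s)).re) (g := fun s : ℝ => (γc' s).re)
        (Complex.continuous_re.comp hgγ) (Complex.continuous_re.comp hγ'))
      fun s => hbound s _ _ (Complex.abs_re_le_norm _) (Complex.abs_re_le_norm _)
  let rP : IntegralRep 1 := ⟨univ, fun z => (g (γc (z 0))).re * (γc' (z 0)).re,
    isSemialgebraic_univ, hPsa, hPint⟩
  -- the representation `[ℝ, -(Im g(γ) · Im γ')]`
  have hQg : IsSemialgebraicFunOn ℚ (univ : Set (Fin 1 → ℝ)) fun z => (g (γc (z 0))).im :=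
    (isSemialgebraicFunOn_comp_gamma halg isSemialgebraic_univ hQs).congr fun z _ => by
      simp only [cx_gamma]
  have hQprod : IsSemialgebraicFunOn ℚ (univ : Set (Fin 1 → ℝ))
      fun z => (g (γc (z 0))).im * (γc' (z 0)).im :=
    IsSemialgebraicFunOn.mul_holds hQg (isSemialgebraicFunOn_gamma'_im halg isSemialgebraic_univ)
  have hQsa : IsSemialgebraicFunOn ℚ (univ : Set (Fin 1 → ℝ))
      fun z => -((g (γc (z 0))).im * (γc' (z 0)).im) :=
    hQprod.neg.congr fun z _ => by simp
  have hQint : IntegrableOn (fun z : Fin 1 → ℝ => -((g (γc (z 0))).im * (γc' (z 0)).im)) univ := by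
    rw [integrableOn_univ]
    refine (integrable_fin1 (F := fun s => (g (γc s)).im * (γc' s).im)
      (Continuous.mul (f := fun s : ℝ => (g (γc s)).im) (g := fun s : ℝ => (γc' s).im)
        (Complex.continuous_im.comp hgγ) (Complex.continuous_im.comp hγ'))
      fun s => hbound s _ _ (Complex.abs_im_le_norm _) (Complex.abs_im_le_norm _)).neg
  let rQ : IntegralRep 1 := ⟨univ, fun z => -((g (γc (z 0))).im * (γc' (z 0)).im),
    isSemialgebraic_univ, hQsa, hQint⟩
  -- rule (1b): `[r] = [rP] + [rQ]`
  have hsplit : of r - of rP - of rQ ∈ relations := by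
    refine integrandAddRel_subset_relations ⟨1, r, rP, rQ, hrd.symm, hrd.symm, fun z _ => ?_, rfl⟩
    rw [hri]
    show _ = (g (γc (z 0))).re * (γc' (z 0)).re + -((g (γc (z 0))).im * (γc' (z 0)).im)
    rw [Complex.mul_re]
    ring
  have hP := boundaryP hρ halg hR hg hPs rP rfl (fun _ => rfl) rd hdd hdi
  have hQ := boundaryQ hρ halg hR hg hQs rQ rfl (fun _ => rfl) rd' hdd' hdi'
  have : of r = (of r - of rP - of rQ) + (of rP + of rd) + (of rQ + of rd') - (of rd + of rd') := by
    abel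
  rw [this]
  exact relations.sub_mem (relations.add_mem (relations.add_mem hsplit hP) hQ) hgreen

end Boundary

end Summit.KontsevichZagierPeriods.ComplexOrientations.CauchyMoveAux

namespace Summit.KontsevichZagierPeriods.ComplexOrientations

open CauchyMoveAux

/-- **`CauchyMove` (route `ComplexOrientations`, item stmt-KontsevichZagierPeriods-11370).** For
`0 < ρ < R` with `ρ` real algebraic, `g` holomorphic on the disc `‖t‖ < R` and algebraic over
`ℚ(t)` (`P(t, g t) = 0` on the disc, `0 ≠ P ∈ ℚ[t, w]`), every integral representation over `ℝ¹`
with integrand `s ↦ Re (g(γ s) γ'(s))`, `γ(s) = ρ (1 + is)/(1 − is)`, lies in `KZ.relations`: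
Cauchy's theorem `Re ∮_{‖t‖ = ρ} g dt = 0` realised as a chain of the printed rules (1)–(3) of
Kontsevich–Zagier (Green on the disc with primitives `Re g`, `Im g`; Cauchy–Riemann).
[cite: KontsevichZagier2001, §1.2] -/
theorem cauchyMove_proof :
    Summit.KontsevichZagierPeriods.KontsevichZagierPeriods.Theses.ComplexOrientations.CauchyMove := by
  unfold Summit.KontsevichZagierPeriods.KontsevichZagierPeriods.Theses.ComplexOrientations.CauchyMove
  intro ρ R g hρ hρR halg hg hP r hrd hri
  obtain ⟨R₁, hρR₁, hR₁R⟩ := exists_rat_btwn hρR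
  have hR₁ : (0 : ℚ) < R₁ := by exact_mod_cast hρ.trans hρR₁
  have hg₁ : DifferentiableOn ℂ g (ball 0 R₁) := hg.mono (ball_subset_ball hR₁R.le)
  -- the polynomial relation in the `(w, t)` convention
  obtain ⟨P, hP0, hPU⟩ := hP
  have hP' : ∃ P' : MvPolynomial (Fin 2) ℚ, P' ≠ 0 ∧
      ∀ t ∈ ball (0 : ℂ) R₁, aeval ![g t, t] P' = 0 := by
    refine ⟨rename ![1, 0] P, ?_, fun t ht => ?_⟩
    · intro h
      refine hP0 (rename_injective (![1, 0] : Fin 2 → Fin 2) (by decide) ?_)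
      rw [h, map_zero]
    · rw [aeval_rename]
      have : (![g t, t] : Fin 2 → ℂ) ∘ (![1, 0] : Fin 2 → Fin 2) = ![t, g t] := by
        funext i; fin_cases i <;> rfl
      rw [this]
      exact hPU t (ball_subset_ball hR₁R.le ht)
  -- Theorem A on the closed disc of radius `ρ`
  have hDs := isSemialgebraic_disc halg
  have hsub : ∀ x ∈ {x : Fin 2 → ℝ | x 0 ^ 2 + x 1 ^ 2 ≤ ρ ^ 2}, (⟨x 0, x 1⟩ : ℂ) ∈ ball (0 : ℂ) R₁ :=
    fun x hx => cx_mem_ball_of_mem_disc hρ hρR₁ hx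
  have hA := re_im_algHolo hR₁ hg₁ hP' hDs hsub
  have hA' := re_im_algHolo_deriv hR₁ hg₁ hP' hDs hsub
  exact cauchy_chain hρ halg hρR₁ hg₁ hA.1 hA.2 hA'.2 r hrd hri

end Summit.KontsevichZagierPeriods.ComplexOrientations
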